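import Literature.NumberTheory.ModularForms.BinaryThetaHigherWeightSlash
import Literature.Analysis.SpecialFunctions.RiemannThetaCharMultiplication
import Mathlib.NumberTheory.ModularForms.Basic
import Mathlib.NumberTheory.ModularForms.CongruenceSubgroups
import Mathlib.LinearAlgebra.Matrix.FixedDetMatrices
import HarnessLib

/-!
# Binary theta series of weight `n + 1` on isotropic lines span an `SL₂(ℤ)`-stable space of cusp-form
# candidates (Hecke 1926 §3; Schoeneberg 1939)

Topic `Literature/NumberTheory/ModularForms`; namespace `Literature.NumberTheory.ModularForms.BinaryTheta`.
Everything here is PROVED (theorems only; no definition, no named fact).  Sequel of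
`BinaryThetaHigherWeightLines` (holomorphy, decay at `i∞`) and `BinaryThetaHigherWeightSlash`
(the inversion, `𝒮ₙ ∣[n+1] S ⊆ span 𝒮ₙ`); the order-`n` analogue of the weight-two Summit-side files
`…HeckeThetaPartnerAdicAtTwoThetaLinesSpan` / `…CuspFormOfSpan` of route `ResidualThetaTransportAtTwo`.

Let `𝒮ₙ` be the set of the functions `τ ↦ Θₙ[a; b; P; u](τ) = ∂ⁿ_s ϑ[a; b](s u, τ·P)|₀` on `ℍ`
(`P ∈ Sym₂(ℚ)` positive definite, `a, b ∈ ℚ²`, `u ∈ ℂ²` with `ᵗu (adj P) u = 0`) and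
`Vₙ = span_ℂ 𝒮ₙ`.  Then

* `iteratedDeriv_line_vadd_mem_span` — `Θₙ[a; b; P; u](τ + j) ∈ Vₙ` (`j ∈ ℤ`): level raising
  `ϑ[a; b](z, Ω) = Σ_{k mod ℓ} ϑ[(a+k)/ℓ; ℓb](ℓz, ℓ²Ω)` (`RiemannThetaCharMultiplication`) with `ℓ = 2N`,
  `NP` integral, turns the period matrix into `τ·(ℓ²P) + S`, `S = jℓ²P` integral symmetric with even
  diagonal, removed by `riemannThetaChar_add_evenIntSymm`; the factor `ℓⁿ` comes from `z = ℓ(su)`;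
* `iteratedDeriv_line_slash_T_zpow_mem_span`, `iteratedDeriv_line_slash_S_mem_span'`,
  **`iteratedDeriv_line_slash_mem_span`** — `Vₙ ∣[n+1] γ ⊆ Vₙ` for all `γ ∈ SL₂(ℤ)` (`S, T` generate);
* `isZeroAtImInfty_of_mem_lineSpan` (`n ≥ 1`), `mdifferentiable_of_mem_lineSpan`;
* **`exists_cuspForm_of_mem_lineSpan`** — for `n ≥ 1`, a function in `Vₙ` invariant under `Γ₀(N)` in
  weight `n + 1` is a cusp form of weight `n + 1` on `Γ₀(N)` (holomorphy and vanishing at every cusp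
  from `Vₙ ∣ SL₂(ℤ) ⊆ Vₙ`).

This is the analytic half of Hecke's theorem that the binary theta series with the harmonic
polynomial `(ᵗu x)ⁿ`, `ᵗu (adj P) u = 0`, are cusp forms of weight `n + 1` (`n ≥ 1`); the arithmetic
half (congruence-subgroup invariance of the Hecke theta series of a Grössencharakter) is not in this file.
No statement about elliptic curves or BSD is proved here.

## References

* E. Hecke, *Zur Theorie der elliptischen Modulfunktionen*, Math. Ann. 97 (1926), §3. [Hecke1926Modulfunktionen]
* D. Zagier, *Elliptic modular forms and their applications* (The 1-2-3 of Modular Forms, 2008), §3.2. [Zagier2008]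
* D. Mumford, *Tata Lectures on Theta I* (1983), Ch. II §1, §5. [MumfordTata1]
-/

noncomputable section

open Matrix Complex Filter Topology Set

open scoped Real MatrixGroups UpperHalfPlane Manifold ModularForm

namespace Literature.NumberTheory.ModularForms.BinaryTheta

open Literature.Analysis.SpecialFunctions
open Literature.NumberTheory.Automorphic (siegelUpperHalfSpace mem_siegelUpperHalfSpace_iff)
open CongruenceSubgroup

/-! ### Two elementary lemmas -/

/-- A rational symmetric `2 × 2` matrix is `N⁻¹ Z` with `Z` integral symmetric, `N ≥ 1`
(twin of the Summit-side `HeckeTheta.exists_intMatrix_eq_smul`). [folklore] -/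
private theorem exists_intSymm_eq_natSmul (P : Matrix (Fin 2) (Fin 2) ℚ) (hPs : P.IsSymm) :
    ∃ (N : ℕ) (Z : Matrix (Fin 2) (Fin 2) ℤ), 0 < N ∧ Z.IsSymm ∧
      Z.map (Int.cast : ℤ → ℚ) = (N : ℚ) • P := by
  have h10 : P 1 0 = P 0 1 := hPs.apply 0 1
  set N : ℕ := (P 0 0).den * (P 0 1).den * (P 1 1).den with hN
  refine ⟨N, !![(P 0 0).num * ((P 0 1).den * (P 1 1).den), (P 0 1).num * ((P 0 0).den * (P 1 1).den);
    (P 0 1).num * ((P 0 0).den * (P 1 1).den), (P 1 1).num * ((P 0 0).den * (P 0 1).den)],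
    by positivity, ?_, ?_⟩
  · ext i j; fin_cases i <;> fin_cases j <;> rfl
  · ext i j
    fin_cases i <;> fin_cases j <;>
      simp only [Matrix.map_apply, Matrix.of_apply, Matrix.cons_val', Matrix.cons_val_zero,
        Matrix.cons_val_one, Matrix.empty_val', Matrix.cons_val_fin_one, Matrix.smul_apply,
        smul_eq_mul, hN, Fin.zero_eta, Fin.mk_one, Fin.isValue, h10] <;>
      push_cast <;>
      [rw [← Rat.mul_den_eq_num (P 0 0)]; rw [← Rat.mul_den_eq_num (P 0 1)];
        rw [← Rat.mul_den_eq_num (P 0 1)]; rw [← Rat.mul_den_eq_num (P 1 1)]] <;>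
      ring

/-- Homogeneity of the `n`-th line derivative in the direction:
`∂ⁿ_s θ(s·(c w))|₀ = cⁿ · ∂ⁿ_s θ(s·w)|₀`. [folklore] -/
private theorem iteratedDeriv_line_dir_smul {m : ℕ} {θ : (Fin m → ℂ) → ℂ} (hθ : Differentiable ℂ θ)
    (w : Fin m → ℂ) (c : ℂ) (n : ℕ) :
    iteratedDeriv n (fun s : ℂ => θ (s • (c • w))) 0 = c ^ n * iteratedDeriv n (fun s : ℂ => θ (s • w)) 0 := by
  have hline : Differentiable ℂ (fun s : ℂ => s • w) := fun s => differentiableAt_id.smul_const w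
  have hfc : ContDiff ℂ n (fun s : ℂ => θ (s • w)) := (hθ.comp hline).contDiff
  have hfun : (fun s : ℂ => θ (s • (c • w))) = fun s => (fun s : ℂ => θ (s • w)) (c * s) := by
    funext s; simp only [smul_smul, mul_comm s c]
  rw [hfun, iteratedDeriv_comp_const_mul hfc c]
  simp only [mul_zero]

/-! ### The translations `T^j` -/

/-- **`Θₙ[a; b; P; u](τ + j) ∈ span 𝒮ₙ`** (`j ∈ ℤ`): with `ℓ = 2N` (`NP` integral) the period matrix of
the level-raised thetas is `ℓ²(τ + j)P = τ·(ℓ²P) + S`, `S = jℓ²P` integral symmetric with even diagonal,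
and `ϑ[a'; b'](w, τ·ℓ²P + S) = e(-πi ᵗa'Sa') ϑ[a'; b' + Sa'](w, τ·ℓ²P)`; the direction `u` stays
isotropic for `adj(ℓ²P) = ℓ² adj P` (order-`n` analogue of the Summit-side `HeckeTheta.vadd_mem_span`).
[cite: Hecke1926Modulfunktionen, §3] -/
theorem iteratedDeriv_line_vadd_mem_span {P : Matrix (Fin 2) (Fin 2) ℚ} (hPs : P.IsSymm)
    (hPpos : (P.map (Rat.cast : ℚ → ℝ)).PosDef) (a b : Fin 2 → ℚ) {u : Fin 2 → ℂ}
    (hu : u ⬝ᵥ ((P.map (Rat.cast : ℚ → ℂ)).adjugate *ᵥ u) = 0) (n : ℕ) (j : ℤ) :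
    (fun τ : ℍ => iteratedDeriv n (fun s : ℂ => riemannThetaChar (fun i => (a i : ℂ)) (fun i => (b i : ℂ))
        ((((j : ℝ) +ᵥ τ : ℍ) : ℂ) • P.map (Rat.cast : ℚ → ℂ)) (s • u)) 0) ∈
      Submodule.span ℂ {F : ℍ → ℂ | ∃ (P : Matrix (Fin 2) (Fin 2) ℚ), P.IsSymm ∧
        (P.map (Rat.cast : ℚ → ℝ)).PosDef ∧ ∃ (a b : Fin 2 → ℚ) (u : Fin 2 → ℂ),
          u ⬝ᵥ ((P.map (Rat.cast : ℚ → ℂ)).adjugate *ᵥ u) = 0 ∧ F = fun τ : ℍ =>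
            iteratedDeriv n (fun s : ℂ => riemannThetaChar (fun i => (a i : ℂ)) (fun i => (b i : ℂ))
              ((τ : ℂ) • P.map (Rat.cast : ℚ → ℂ)) (s • u)) 0} := by
  obtain ⟨N, Z, hN, hZs, hZ⟩ := exists_intSymm_eq_natSmul P hPs
  have hZentry : ∀ k l, ((Z k l : ℤ) : ℚ) = (N : ℚ) * P k l := fun k l => by
    have := congrArg (fun M : Matrix (Fin 2) (Fin 2) ℚ => M k l) hZ
    simpa [Matrix.map_apply, Matrix.smul_apply] using this
  set ℓ : ℕ := 2 * N with hℓ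
  have hℓpos : 0 < ℓ := by omega
  -- the integral shift `S = j ℓ² P`
  set S : Matrix (Fin 2) (Fin 2) ℤ := (4 * j * (N : ℤ)) • Z with hSdef
  have hSs : S.IsSymm := hZs.smul _
  have hSeven : ∀ k, Even (S k k) := fun k =>
    ⟨2 * j * N * Z k k, by simp only [hSdef, Matrix.smul_apply, smul_eq_mul]; ring⟩
  have hSℂ : S.map ((↑) : ℤ → ℂ) = ((j : ℂ) * (ℓ : ℂ) ^ 2) • P.map (Rat.cast : ℚ → ℂ) := by
    ext k l
    simp only [Matrix.map_apply, Matrix.smul_apply, smul_eq_mul, hSdef, hℓ]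
    have h := hZentry k l
    have h' : ((Z k l : ℤ) : ℂ) = (N : ℂ) * ((P k l : ℚ) : ℂ) := by exact_mod_cast h
    push_cast
    rw [h']
    ring
  -- the new line matrix `ℓ² P`
  set P'' : Matrix (Fin 2) (Fin 2) ℚ := ((ℓ : ℚ) ^ 2) • P with hP''
  have hP''s : P''.IsSymm := hPs.smul _
  have hP''pos : (P''.map (Rat.cast : ℚ → ℝ)).PosDef := by
    have : P''.map (Rat.cast : ℚ → ℝ) = ((ℓ : ℝ) ^ 2) • P.map (Rat.cast : ℚ → ℝ) := by
      ext k l; simp [hP'', Matrix.smul_apply]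
    rw [this]
    exact hPpos.smul (by positivity)
  have hP''c : P''.map (Rat.cast : ℚ → ℂ) = ((ℓ : ℂ) ^ 2) • P.map (Rat.cast : ℚ → ℂ) := by
    ext k l; simp [hP'', Matrix.smul_apply]
  -- `u` stays isotropic for `adj(ℓ² P) = ℓ² adj P`
  have hu'' : u ⬝ᵥ ((P''.map (Rat.cast : ℚ → ℂ)).adjugate *ᵥ u) = 0 := by
    rw [hP''c, Matrix.adjugate_smul, Fintype.card_fin, Matrix.smul_mulVec, dotProduct_smul, hu,
      smul_zero]
  -- the new characteristics
  set a' : (Fin 2 → Fin ℓ) → Fin 2 → ℚ := fun m₀ i => (a i + ((m₀ i : ℕ) : ℚ)) / ℓ with ha'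
  set b' : (Fin 2 → Fin ℓ) → Fin 2 → ℚ := fun m₀ =>
    (fun i => (ℓ : ℚ) * b i) + S.map ((↑) : ℤ → ℚ) *ᵥ a' m₀ with hb'
  have ha'c : ∀ m₀, (fun i => ((a' m₀ i : ℚ) : ℂ)) =
      (ℓ : ℂ)⁻¹ • ((fun i => (a i : ℂ)) + fun i => ((m₀ i : ℕ) : ℂ)) := by
    intro m₀; funext i
    simp only [ha', Pi.smul_apply, Pi.add_apply, smul_eq_mul]
    push_cast
    ring
  have hb'c : ∀ m₀, (fun i => ((b' m₀ i : ℚ) : ℂ)) =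
      (ℓ : ℂ) • (fun i => (b i : ℂ)) + S.map ((↑) : ℤ → ℂ) *ᵥ fun i => ((a' m₀ i : ℚ) : ℂ) := by
    intro m₀; funext i
    simp only [hb', Pi.add_apply, Pi.smul_apply, smul_eq_mul, Matrix.mulVec, dotProduct,
      Fin.sum_univ_two, Matrix.map_apply]
    push_cast
    ring
  -- the phases
  set c' : (Fin 2 → Fin ℓ) → ℂ := fun m₀ =>
    cexp (-(π * I * ((fun i => ((a' m₀ i : ℚ) : ℂ)) ⬝ᵥ
      (S.map ((↑) : ℤ → ℂ) *ᵥ fun i => ((a' m₀ i : ℚ) : ℂ))))) with hc'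
  -- the generators in the decomposition
  have hmem : ∀ m₀, (fun τ : ℍ => iteratedDeriv n (fun s : ℂ => riemannThetaChar
      (fun i => ((a' m₀ i : ℚ) : ℂ)) (fun i => ((b' m₀ i : ℚ) : ℂ)) ((τ : ℂ) • P''.map (Rat.cast : ℚ → ℂ))
      (s • u)) 0) ∈
      Submodule.span ℂ {F : ℍ → ℂ | ∃ (P : Matrix (Fin 2) (Fin 2) ℚ), P.IsSymm ∧
        (P.map (Rat.cast : ℚ → ℝ)).PosDef ∧ ∃ (a b : Fin 2 → ℚ) (u : Fin 2 → ℂ),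
          u ⬝ᵥ ((P.map (Rat.cast : ℚ → ℂ)).adjugate *ᵥ u) = 0 ∧ F = fun τ : ℍ =>
            iteratedDeriv n (fun s : ℂ => riemannThetaChar (fun i => (a i : ℂ)) (fun i => (b i : ℂ))
              ((τ : ℂ) • P.map (Rat.cast : ℚ → ℂ)) (s • u)) 0} :=
    fun m₀ => Submodule.subset_span ⟨P'', hP''s, hP''pos, a' m₀, b' m₀, u, hu'', rfl⟩
  -- the pointwise decomposition
  have hdecomp : (fun τ : ℍ => iteratedDeriv n (fun s : ℂ => riemannThetaChar (fun i => (a i : ℂ))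
        (fun i => (b i : ℂ)) ((((j : ℝ) +ᵥ τ : ℍ) : ℂ) • P.map (Rat.cast : ℚ → ℂ)) (s • u)) 0) =
      ∑ m₀ : Fin 2 → Fin ℓ, (c' m₀ * (ℓ : ℂ) ^ n) • fun τ : ℍ => iteratedDeriv n (fun s : ℂ =>
        riemannThetaChar (fun i => ((a' m₀ i : ℚ) : ℂ)) (fun i => ((b' m₀ i : ℚ) : ℂ))
          ((τ : ℂ) • P''.map (Rat.cast : ℚ → ℂ)) (s • u)) 0 := by
    funext τ
    simp only [Finset.sum_apply, Pi.smul_apply, smul_eq_mul]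
    set τ' : ℂ := (((j : ℝ) +ᵥ τ : ℍ) : ℂ) with hτ'
    have hτ'im : 0 < τ'.im := ((j : ℝ) +ᵥ τ).im_pos
    have hτ'eq : τ' = (τ : ℂ) + j := by rw [hτ', UpperHalfPlane.coe_vadd]; push_cast; ring
    obtain ⟨hsym, c₀, hc₀, hY₀⟩ := ratLine_hyps hPs hPpos hτ'im
    -- level raising and the shift, as an identity of functions of `z`
    have hsplit : ((ℓ : ℂ) ^ 2) • (τ' • P.map (Rat.cast : ℚ → ℂ)) =
        (τ : ℂ) • P''.map (Rat.cast : ℚ → ℂ) + S.map ((↑) : ℤ → ℂ) := by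
      rw [hP''c, hSℂ, smul_smul, smul_smul, ← add_smul, hτ'eq]
      congr 1; ring
    have hfun : ∀ z : Fin 2 → ℂ, riemannThetaChar (fun i => (a i : ℂ)) (fun i => (b i : ℂ))
        (τ' • P.map (Rat.cast : ℚ → ℂ)) z =
        ∑ m₀ : Fin 2 → Fin ℓ, c' m₀ *
          riemannThetaChar (fun i => ((a' m₀ i : ℚ) : ℂ)) (fun i => ((b' m₀ i : ℚ) : ℂ))
            ((τ : ℂ) • P''.map (Rat.cast : ℚ → ℂ)) ((ℓ : ℂ) • z) := by
      intro z
      rw [riemannThetaChar_eq_sum_level _ hsym hc₀ hY₀ hℓpos _ _ z]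
      refine Finset.sum_congr rfl fun m₀ _ => ?_
      rw [hsplit, ← ha'c m₀, riemannThetaChar_add_evenIntSymm hSs (hSeven 0) (hSeven 1), ← hb'c m₀]
    -- differentiate `n` times at `s = 0` along `s ↦ s u`; `ℓ(su) = s(ℓu)` gives the factor `ℓⁿ`
    obtain ⟨hsym'', c₁, hc₁, hY₁⟩ := ratLine_hyps hP''s hP''pos τ.im_pos
    have hd : ∀ m₀ : Fin 2 → Fin ℓ, Differentiable ℂ (riemannThetaChar (fun i => ((a' m₀ i : ℚ) : ℂ))
        (fun i => ((b' m₀ i : ℚ) : ℂ)) ((τ : ℂ) • P''.map (Rat.cast : ℚ → ℂ))) := fun m₀ =>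
      differentiable_riemannThetaChar _ hsym'' hc₁ hY₁ _ _
    have hsm : ∀ w : Fin 2 → ℂ, Differentiable ℂ (fun s : ℂ => s • w) := fun w s =>
      differentiableAt_id.smul_const w
    have hcd : ∀ m₀ : Fin 2 → Fin ℓ, ContDiff ℂ n (fun s : ℂ => riemannThetaChar
        (fun i => ((a' m₀ i : ℚ) : ℂ)) (fun i => ((b' m₀ i : ℚ) : ℂ)) ((τ : ℂ) • P''.map (Rat.cast : ℚ → ℂ))
        (s • ((ℓ : ℂ) • u))) := fun m₀ => ((hd m₀).comp (hsm _)).contDiff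
    have hline : (fun s : ℂ => riemannThetaChar (fun i => (a i : ℂ)) (fun i => (b i : ℂ))
        (τ' • P.map (Rat.cast : ℚ → ℂ)) (s • u)) = fun s => ∑ m₀ : Fin 2 → Fin ℓ, c' m₀ *
          riemannThetaChar (fun i => ((a' m₀ i : ℚ) : ℂ)) (fun i => ((b' m₀ i : ℚ) : ℂ))
            ((τ : ℂ) • P''.map (Rat.cast : ℚ → ℂ)) (s • ((ℓ : ℂ) • u)) := by
      funext s
      rw [hfun (s • u), smul_comm (ℓ : ℂ) s u]
    rw [hline, iteratedDeriv_fun_sum fun m₀ _ => (contDiff_const.mul (hcd m₀)).contDiffAt]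
    refine Finset.sum_congr rfl fun m₀ _ => ?_
    rw [iteratedDeriv_const_mul _ (hcd m₀).contDiffAt, iteratedDeriv_line_dir_smul (hd m₀) u (ℓ : ℂ) n]
    ring
  rw [hdecomp]
  exact Submodule.sum_mem _ fun m₀ _ => Submodule.smul_mem _ _ (hmem m₀)

/-- **`span 𝒮ₙ ∣[n+1] T^j ⊆ span 𝒮ₙ`.** [cite: Hecke1926Modulfunktionen, §3] -/
theorem iteratedDeriv_line_slash_T_zpow_mem_span (n : ℕ) (j : ℤ) {F : ℍ → ℂ}
    (hF : F ∈ Submodule.span ℂ {F : ℍ → ℂ | ∃ (P : Matrix (Fin 2) (Fin 2) ℚ), P.IsSymm ∧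
        (P.map (Rat.cast : ℚ → ℝ)).PosDef ∧ ∃ (a b : Fin 2 → ℚ) (u : Fin 2 → ℂ),
          u ⬝ᵥ ((P.map (Rat.cast : ℚ → ℂ)).adjugate *ᵥ u) = 0 ∧ F = fun τ : ℍ =>
            iteratedDeriv n (fun s : ℂ => riemannThetaChar (fun i => (a i : ℂ)) (fun i => (b i : ℂ))
              ((τ : ℂ) • P.map (Rat.cast : ℚ → ℂ)) (s • u)) 0}) :
    (F ∣[((n + 1 : ℕ) : ℤ)] (ModularGroup.T ^ j)) ∈
      Submodule.span ℂ {F : ℍ → ℂ | ∃ (P : Matrix (Fin 2) (Fin 2) ℚ), P.IsSymm ∧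
        (P.map (Rat.cast : ℚ → ℝ)).PosDef ∧ ∃ (a b : Fin 2 → ℚ) (u : Fin 2 → ℂ),
          u ⬝ᵥ ((P.map (Rat.cast : ℚ → ℂ)).adjugate *ᵥ u) = 0 ∧ F = fun τ : ℍ =>
            iteratedDeriv n (fun s : ℂ => riemannThetaChar (fun i => (a i : ℂ)) (fun i => (b i : ℂ))
              ((τ : ℂ) • P.map (Rat.cast : ℚ → ℂ)) (s • u)) 0} := by
  have hslash : ∀ G : ℍ → ℂ, (G ∣[((n + 1 : ℕ) : ℤ)] (ModularGroup.T ^ j)) = fun τ => G ((j : ℝ) +ᵥ τ) := by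
    intro G
    funext τ
    rw [ModularForm.SL_slash_apply, ModularGroup.denom_apply, UpperHalfPlane.modular_T_zpow_smul,
      ModularGroup.coe_T_zpow]
    simp
  induction hF using Submodule.span_induction with
  | mem G hG =>
    obtain ⟨P, hPs, hPpos, a, b, u, hu, rfl⟩ := hG
    rw [hslash]
    exact iteratedDeriv_line_vadd_mem_span hPs hPpos a b hu n j
  | zero => rw [SlashAction.zero_slash]; exact Submodule.zero_mem _
  | add G G' _ _ hG hG' => rw [SlashAction.add_slash]; exact Submodule.add_mem _ hG hG'
  | smul c G _ hG => rw [ModularForm.SL_smul_slash]; exact Submodule.smul_mem _ _ hG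

/-! ### The inversion `S` and all of `SL₂(ℤ)` -/

/-- **`span 𝒮ₙ ∣[n+1] S ⊆ span 𝒮ₙ`.** [cite: Hecke1926Modulfunktionen, §3] -/
theorem iteratedDeriv_line_slash_S_mem_span' (n : ℕ) {F : ℍ → ℂ}
    (hF : F ∈ Submodule.span ℂ {F : ℍ → ℂ | ∃ (P : Matrix (Fin 2) (Fin 2) ℚ), P.IsSymm ∧
        (P.map (Rat.cast : ℚ → ℝ)).PosDef ∧ ∃ (a b : Fin 2 → ℚ) (u : Fin 2 → ℂ),
          u ⬝ᵥ ((P.map (Rat.cast : ℚ → ℂ)).adjugate *ᵥ u) = 0 ∧ F = fun τ : ℍ =>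
            iteratedDeriv n (fun s : ℂ => riemannThetaChar (fun i => (a i : ℂ)) (fun i => (b i : ℂ))
              ((τ : ℂ) • P.map (Rat.cast : ℚ → ℂ)) (s • u)) 0}) :
    (F ∣[((n + 1 : ℕ) : ℤ)] ModularGroup.S) ∈
      Submodule.span ℂ {F : ℍ → ℂ | ∃ (P : Matrix (Fin 2) (Fin 2) ℚ), P.IsSymm ∧
        (P.map (Rat.cast : ℚ → ℝ)).PosDef ∧ ∃ (a b : Fin 2 → ℚ) (u : Fin 2 → ℂ),
          u ⬝ᵥ ((P.map (Rat.cast : ℚ → ℂ)).adjugate *ᵥ u) = 0 ∧ F = fun τ : ℍ =>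
            iteratedDeriv n (fun s : ℂ => riemannThetaChar (fun i => (a i : ℂ)) (fun i => (b i : ℂ))
              ((τ : ℂ) • P.map (Rat.cast : ℚ → ℂ)) (s • u)) 0} := by
  induction hF using Submodule.span_induction with
  | mem G hG =>
    obtain ⟨P, hPs, hPpos, a, b, u, hu, rfl⟩ := hG
    exact iteratedDeriv_line_slash_S_mem_span hPs hPpos a b hu n
  | zero => rw [SlashAction.zero_slash]; exact Submodule.zero_mem _
  | add G G' _ _ hG hG' => rw [SlashAction.add_slash]; exact Submodule.add_mem _ hG hG'
  | smul c G _ hG => rw [ModularForm.SL_smul_slash]; exact Submodule.smul_mem _ _ hG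

/-- **The span `Vₙ = span 𝒮ₙ` is stable under `SL₂(ℤ)` in weight `n + 1`.**
[cite: Hecke1926Modulfunktionen, §3] -/
theorem iteratedDeriv_line_slash_mem_span (n : ℕ) (γ : SL(2, ℤ)) {F : ℍ → ℂ}
    (hF : F ∈ Submodule.span ℂ {F : ℍ → ℂ | ∃ (P : Matrix (Fin 2) (Fin 2) ℚ), P.IsSymm ∧
        (P.map (Rat.cast : ℚ → ℝ)).PosDef ∧ ∃ (a b : Fin 2 → ℚ) (u : Fin 2 → ℂ),
          u ⬝ᵥ ((P.map (Rat.cast : ℚ → ℂ)).adjugate *ᵥ u) = 0 ∧ F = fun τ : ℍ =>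
            iteratedDeriv n (fun s : ℂ => riemannThetaChar (fun i => (a i : ℂ)) (fun i => (b i : ℂ))
              ((τ : ℂ) • P.map (Rat.cast : ℚ → ℂ)) (s • u)) 0}) :
    (F ∣[((n + 1 : ℕ) : ℤ)] γ) ∈
      Submodule.span ℂ {F : ℍ → ℂ | ∃ (P : Matrix (Fin 2) (Fin 2) ℚ), P.IsSymm ∧
        (P.map (Rat.cast : ℚ → ℝ)).PosDef ∧ ∃ (a b : Fin 2 → ℚ) (u : Fin 2 → ℂ),
          u ⬝ᵥ ((P.map (Rat.cast : ℚ → ℂ)).adjugate *ᵥ u) = 0 ∧ F = fun τ : ℍ =>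
            iteratedDeriv n (fun s : ℂ => riemannThetaChar (fun i => (a i : ℂ)) (fun i => (b i : ℂ))
              ((τ : ℂ) • P.map (Rat.cast : ℚ → ℂ)) (s • u)) 0} := by
  have hγ : γ ∈ Subgroup.closure {ModularGroup.S, ModularGroup.T} := by
    rw [SpecialLinearGroup.SL2Z_generators]; trivial
  induction hγ using Subgroup.closure_induction'' generalizing F with
  | one => rw [SlashAction.slash_one]; exact hF
  | mem g hg =>
    simp only [Set.mem_insert_iff, Set.mem_singleton_iff] at hg
    rcases hg with rfl | rfl
    · exact iteratedDeriv_line_slash_S_mem_span' n hF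
    · have := iteratedDeriv_line_slash_T_zpow_mem_span n 1 hF
      rwa [zpow_one] at this
  | inv_mem g hg =>
    simp only [Set.mem_insert_iff, Set.mem_singleton_iff] at hg
    rcases hg with rfl | rfl
    · have hS : ModularGroup.S⁻¹ = ModularGroup.S * ModularGroup.S * ModularGroup.S := by
        ext i j
        fin_cases i <;> fin_cases j <;> simp [ModularGroup.S]
      rw [hS, SlashAction.slash_mul, SlashAction.slash_mul]
      exact iteratedDeriv_line_slash_S_mem_span' n (iteratedDeriv_line_slash_S_mem_span' n
        (iteratedDeriv_line_slash_S_mem_span' n hF))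
    · have := iteratedDeriv_line_slash_T_zpow_mem_span n (-1) hF
      rwa [_root_.zpow_neg_one] at this
  | mul g g' _ _ ihg ihg' =>
    rw [SlashAction.slash_mul]
    exact ihg' (ihg hF)

/-! ### Decay and holomorphy on the span; cusp forms -/

/-- Every function in `span 𝒮ₙ` (`n ≥ 1`) tends to `0` at `i∞`. [cite: Hecke1926Modulfunktionen, §3] -/
theorem isZeroAtImInfty_of_mem_lineSpan {n : ℕ} (hn : 1 ≤ n) {F : ℍ → ℂ}
    (hF : F ∈ Submodule.span ℂ {F : ℍ → ℂ | ∃ (P : Matrix (Fin 2) (Fin 2) ℚ), P.IsSymm ∧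
        (P.map (Rat.cast : ℚ → ℝ)).PosDef ∧ ∃ (a b : Fin 2 → ℚ) (u : Fin 2 → ℂ),
          u ⬝ᵥ ((P.map (Rat.cast : ℚ → ℂ)).adjugate *ᵥ u) = 0 ∧ F = fun τ : ℍ =>
            iteratedDeriv n (fun s : ℂ => riemannThetaChar (fun i => (a i : ℂ)) (fun i => (b i : ℂ))
              ((τ : ℂ) • P.map (Rat.cast : ℚ → ℂ)) (s • u)) 0}) :
    UpperHalfPlane.IsZeroAtImInfty F := by
  induction hF using Submodule.span_induction with
  | mem G hG =>
    obtain ⟨P, hPs, hPpos, a, b, u, -, rfl⟩ := hG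
    exact isZeroAtImInfty_iteratedDeriv_line hPs hPpos a b u hn
  | zero => exact (UpperHalfPlane.zeroAtImInftySubmodule ℂ).zero_mem
  | add G G' _ _ hG hG' => exact (UpperHalfPlane.zeroAtImInftySubmodule ℂ).add_mem hG hG'
  | smul c G _ hG => exact (UpperHalfPlane.zeroAtImInftySubmodule ℂ).smul_mem c hG

/-- Every function in `span 𝒮ₙ` is holomorphic on `ℍ`. [cite: Hecke1926Modulfunktionen, §3] -/
theorem mdifferentiable_of_mem_lineSpan {n : ℕ} {F : ℍ → ℂ}
    (hF : F ∈ Submodule.span ℂ {F : ℍ → ℂ | ∃ (P : Matrix (Fin 2) (Fin 2) ℚ), P.IsSymm ∧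
        (P.map (Rat.cast : ℚ → ℝ)).PosDef ∧ ∃ (a b : Fin 2 → ℚ) (u : Fin 2 → ℂ),
          u ⬝ᵥ ((P.map (Rat.cast : ℚ → ℂ)).adjugate *ᵥ u) = 0 ∧ F = fun τ : ℍ =>
            iteratedDeriv n (fun s : ℂ => riemannThetaChar (fun i => (a i : ℂ)) (fun i => (b i : ℂ))
              ((τ : ℂ) • P.map (Rat.cast : ℚ → ℂ)) (s • u)) 0}) :
    MDifferentiable 𝓘(ℂ) 𝓘(ℂ) F := by
  induction hF using Submodule.span_induction with
  | mem G hG =>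
    obtain ⟨P, hPs, hPpos, a, b, u, -, rfl⟩ := hG
    exact mdifferentiable_iteratedDeriv_line hPs hPpos a b u n
  | zero => exact mdifferentiable_const
  | add G G' _ _ hG hG' => exact hG.add hG'
  | smul c G _ hG => exact hG.const_smul c

/-- **A `Γ₀(N)`-invariant function in `span 𝒮ₙ` (`n ≥ 1`) is a cusp form of weight `n + 1` on `Γ₀(N)`**:
holomorphy and vanishing at EVERY cusp come from `span 𝒮ₙ ∣ SL₂(ℤ) ⊆ span 𝒮ₙ`, each element of the span
being holomorphic and `o(1)` at `i∞` (order-`n` analogue of the Summit-side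
`HeckeTheta.exists_cuspForm_of_mem_span`). [cite: Hecke1926Modulfunktionen, §3] -/
theorem exists_cuspForm_of_mem_lineSpan (N : ℕ) [NeZero N] {n : ℕ} (hn : 1 ≤ n) {f : ℍ → ℂ}
    (hf : f ∈ Submodule.span ℂ {F : ℍ → ℂ | ∃ (P : Matrix (Fin 2) (Fin 2) ℚ), P.IsSymm ∧
        (P.map (Rat.cast : ℚ → ℝ)).PosDef ∧ ∃ (a b : Fin 2 → ℚ) (u : Fin 2 → ℂ),
          u ⬝ᵥ ((P.map (Rat.cast : ℚ → ℂ)).adjugate *ᵥ u) = 0 ∧ F = fun τ : ℍ =>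
            iteratedDeriv n (fun s : ℂ => riemannThetaChar (fun i => (a i : ℂ)) (fun i => (b i : ℂ))
              ((τ : ℂ) • P.map (Rat.cast : ℚ → ℂ)) (s • u)) 0})
    (hinv : ∀ γ : SL(2, ℤ), γ ∈ Gamma0 N → f ∣[((n + 1 : ℕ) : ℤ)] γ = f) :
    ∃ g : CuspForm (Gamma0 N) ((n + 1 : ℕ) : ℤ), (⇑g : ℍ → ℂ) = f := by
  refine ⟨{ toFun := f,
             slash_action_eq' := fun γ hγ => ?_,
             holo' := mdifferentiable_of_mem_lineSpan hf,
             zero_at_cusps' := fun {c} hc => ?_ }, rfl⟩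
  · obtain ⟨γ₀, hγ₀, rfl⟩ := hγ
    exact (show f ∣[((n + 1 : ℕ) : ℤ)] (γ₀ : GL (Fin 2) ℝ) = f by
      rw [← ModularForm.SL_slash]; exact hinv γ₀ hγ₀)
  · rw [Subgroup.IsArithmetic.isCusp_iff_isCusp_SL2Z] at hc
    rw [OnePoint.isZeroAt_iff_forall_SL2Z hc]
    intro γ _
    exact isZeroAtImInfty_of_mem_lineSpan hn (iteratedDeriv_line_slash_mem_span n γ hf)

end Literature.NumberTheory.ModularForms.BinaryTheta
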